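import Summits.AnomalousDissipation.AnomalousDissipation.Theorems.MomentParityQuarticTightnessGateRelative
import Summits.AnomalousDissipation.AnomalousDissipation.Theorems.GalerkinInvariantLoud.Negative.Clauses
import Literature.Analysis.FluidPDE.TimeAverageMeasureBasic

/-!
# Strategy census v3 — typed companion of seat b1 (crux-strategist, stmt-AnomalousDissipation-14331
`QuarticTightness`; routes QuarticLadder rev 5 / MomentParity; 2026-08-17)

Companion to `Cruxes/QuarticTightness/STRATEGY-CENSUS.md` v3 (§T0 there). Seat s1's companion
`StrategyCensus.lean` typed the switches available on 2026-08-17 02:49Z; since then the line lead c13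
LANDED the gate-relative anatomy (`MomentParityQuarticTightnessGateRelative`:
`stub_quarticTightnessIffGateInvariantFamily`, QT ⟺ "gate hypothesis ⇒ loud bounded Galerkin-INVARIANT
family") and the sibling crux `GalerkinInvariantLoud` (stmt-14283) moved to the line
`conley-continuation-loud-saddles` r2, whose single load-bearing stub is `stub_indexedLoudShadows`
(∃ force: loud norm-compact NS-invariant carriers `K_j`, shadowed by forward-invariant level-`N` sets,
`j`-UNIFORM window).

This file types the ONE transfer that the new state of the tree makes available for THIS crux and was not
in s1's census — TRANSFER AT CRUX LEVEL FROM THE STAFFED SIBLING'S LIVE CURRENCY — and certifies its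
position, sorry-free:

* `GalerkinKB`, `LoudCarrierUSC` — the sibling line's two provable stubs, VERBATIM (Galerkin
  Krylov–Bogoliubov for tested paths; upper semicontinuity of invariant Galerkin laws onto a compact loud
  carrier). They are force-universal already.
* `ShadowData f ν E ε` — the per-`(f, ν_j)` body of the sibling's XL stub; `GateShadows` — its
  GATE-RELATIVE UNIVERSAL form (gate hypothesis ⇒ shadow data with a `j`-uniform window), i.e. the exact
  statement a lead on THIS crux would have to prove if it adopted the sibling's mechanism.
* `invariantFamily_of_shadowData` — the sibling's kernel-checked composition, made parametric in the force:
  shadow data at every `j` ⇒ `InvariantFamily f ν E ε`.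
* `quarticTightness_of_gateShadows : GalerkinKB → LoudCarrierUSC → GateShadows → QuarticTightness` — the
  transferred line CLOSES the crux (through the landed S14).
* `siblingStub_of_gateShadows : GateShadows → QuarticGate → (sibling stub_indexedLoudShadows)` — and its
  load-bearing stub DOMINATES the sibling's own XL stub as soon as the rank-2 crux `QuarticGate` holds
  (binder 1 of QuarticLadder's `closes`, staffed, lead c15): the transfer is the sibling's open problem in
  a harder (∀-gate-force) currency, not a new handle. This is the typed form of census v3 §T0 and of the
  recommendation "do not seat a second lead on 14331; park it behind 14283 ∧ 11464".

* §S7 `floorInterval_of_floorSeq` — the sequential floor of a force (its UEF reading) already yields ONE pair of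
  budgets on a whole interval `(0, ν₀]` of viscosities (diagonal argument + budget monotonicity): "for all
  ν ≤ ν₀" is not a stronger target and exposes no continuation parameter (census v3 §Strengthen S7).

No new definitions enter the tree (this is a crux workfile); nothing here proves a Theses decl.
-/

noncomputable section

set_option linter.dupNamespace false
set_option linter.unusedVariables false

namespace Summit.AnomalousDissipation.AnomalousDissipation.Cruxes.QuarticTightness.StrategyCensusB1

open MeasureTheory Filter Topology Set Metric
open scoped ENNReal InnerProductSpace RealInnerProductSpace
open Literature.Analysis.FunctionSpaces Literature.Analysis.FluidPDE
open Summit.AnomalousDissipation.AnomalousDissipation.Theses.MomentParity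
open Summit.AnomalousDissipation.AnomalousDissipation.Theorems
open Summit.AnomalousDissipation.AnomalousDissipation.Theorems.QuarticGate.Negative
open Summit.AnomalousDissipation.AnomalousDissipation.Theorems.QuarticTightness.Negative
open Summit.AnomalousDissipation.AnomalousDissipation.Theorems.GalerkinInvariantLoud.Negative (IsInvariant)
open Summit.AnomalousDissipation.AnomalousDissipation.Theorems.MomentParityQuarticTightness
  (stub_quarticTightnessIffGateInvariantFamily)
open Summit.AnomalousDissipation.AnomalousDissipation.Theorems.CubicParityLoud.Negative (T3 R3 H3)

/-! ## The sibling line's two provable stubs, verbatim (force-universal as they stand) -/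

/-- **KB** — `conley-continuation-loud-saddles` Stub 1 verbatim: Galerkin Krylov–Bogoliubov + Liouville for
tested level-`N` paths, generalized-limit form. [folklore] -/
def GalerkinKB : Prop :=
    ∀ (ν : ℝ) (f : T3 → R3) (N : ℕ) (R : ℝ) (U : ℝ → H3),
      Torus.IsSmooth f →
      ContinuousOn U (Ici 0) → (∀ t, 0 ≤ t → IsLevel N (U t)) → (∀ t, 0 ≤ t → ‖U t‖ ≤ R) →
      (∀ a : T3 → R3, IsBandTest N a → ∀ s t : ℝ, 0 ≤ s → s ≤ t →
        Torus.pairing (U t).1 a - Torus.pairing (U s).1 a =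
          ∫ τ in s..t, Torus.nsGeneratorPairing ν f (U τ) a) →
      ∀ Λ : GeneralizedLimit, ∃ μ : Measure H3,
        Torus.IsTimeAverageMeasure Λ.longTimeAvg U μ ∧ IsInvariant ν f N μ

/-- **USC** — `conley-continuation-loud-saddles` Stub 2 verbatim: upper semicontinuity of invariant
Galerkin laws onto a norm-compact loud carrier at fixed `ν > 0`. [folklore] -/
def LoudCarrierUSC : Prop :=
    ∀ (ν : ℝ) (f : T3 → R3) (E ε : ℝ) (K : Set H3) (Ks : ℕ → Set H3), 0 < ν → Torus.IsSmooth f →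
      IsCompact K →
      (∀ μ : Measure H3, IsProbabilityMeasure μ → μ Kᶜ = 0 →
        (∀ Φ : Torus.CylindricalTest (Fin 3),
          Integrable (fun u => Torus.nsGeneratorPairing ν f u (Φ.grad u)) μ ∧
            ∫ u, Torus.nsGeneratorPairing ν f u (Φ.grad u) ∂μ = 0) →
        Torus.ensembleEnergy μ < E ∧ ε < Torus.ensembleDissipation ν μ) →
      (∀ᶠ N in atTop, ∀ a ∈ Ks N, IsLevel N a) →
      (∀ η : ℝ, 0 < η → ∀ᶠ N in atTop, ∀ a ∈ Ks N, ∃ b ∈ K, ‖a - b‖ < η) →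
      ∀ᶠ N in atTop, ∀ μ : Measure H3, IsProbabilityMeasure μ → μ (Ks N)ᶜ = 0 →
        IsInvariant ν f N μ → Torus.ensembleEnergy μ ≤ E ∧ ε ≤ Torus.ensembleDissipation ν μ

/-! ## The load-bearing stub, per force and gate-relative -/

/-- **Shadow data** of the force `f` at viscosity `ν` with window `(E, ε)`: a norm-compact set `K ⊆ H` all of
whose NS-stationary laws at `(ν, f)` are loud-bounded, shadowed for all large `N` by nonempty closed level-`N`
sets forward-invariant for the tested Galerkin dynamics, accumulating on `K` in norm — the per-`j` body of
the sibling's `stub_indexedLoudShadows`, with the force a PARAMETER. -/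
def ShadowData (f : T3 → R3) (ν E ε : ℝ) : Prop :=
  ∃ (K : Set H3) (Ks : ℕ → Set H3), IsCompact K ∧
    (∀ μ : Measure H3, IsProbabilityMeasure μ → μ Kᶜ = 0 →
      (∀ Φ : Torus.CylindricalTest (Fin 3),
        Integrable (fun u => Torus.nsGeneratorPairing ν f u (Φ.grad u)) μ ∧
          ∫ u, Torus.nsGeneratorPairing ν f u (Φ.grad u) ∂μ = 0) →
      Torus.ensembleEnergy μ < E ∧ ε < Torus.ensembleDissipation ν μ) ∧
    (∀ᶠ N in atTop, (Ks N).Nonempty ∧ IsClosed (Ks N) ∧ (∀ a ∈ Ks N, IsLevel N a) ∧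
      ∀ a ∈ Ks N, ∃ U : ℝ → H3, ContinuousOn U (Ici 0) ∧ U 0 = a ∧ (∀ t, 0 ≤ t → U t ∈ Ks N) ∧
        ∀ b : T3 → R3, IsBandTest N b → ∀ s t : ℝ, 0 ≤ s → s ≤ t →
          Torus.pairing (U t).1 b - Torus.pairing (U s).1 b =
            ∫ τ in s..t, Torus.nsGeneratorPairing ν f (U τ) b) ∧
    (∀ η : ℝ, 0 < η → ∀ᶠ N in atTop, ∀ a ∈ Ks N, ∃ b ∈ K, ‖a - b‖ < η)

/-- **GateShadows** — the transferred load-bearing stub for THIS crux: for every admissible force, null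
sequence and budgets, the GATE HYPOTHESIS yields shadow data with a `j`-UNIFORM window. -/
def GateShadows : Prop :=
  ∀ f : T3 → R3, Torus.IsSmooth f → Torus.IsDivFree f → Torus.HasZeroMean f →
    ∀ (ν : ℕ → ℝ) (E ε : ℝ), (∀ j, 0 < ν j) → Tendsto ν atTop (𝓝 0) → 0 < ε →
    GateHyp f ν E ε → ∃ E' ε' : ℝ, 0 < ε' ∧ ∀ j : ℕ, ShadowData f (ν j) E' ε'

/-! ## The composition, parametric in the force (sibling's proof, force abstracted) -/

/-- **Shadow data at one viscosity ⇒ loud bounded Galerkin-invariant witnesses at frequently many levels**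
(radius from compactness of `K` + accumulation at `η = 1`; Stub 1 produces the time-average law of one
shadowed Galerkin path, Stub 2 makes it loud-bounded). [folklore] -/
theorem invariantWitnesses_of_shadowData (hKB : GalerkinKB) (hUSC : LoudCarrierUSC) {f : T3 → R3}
    (hfs : Torus.IsSmooth f) {ν E ε : ℝ} (hν : 0 < ν) (h : ShadowData f ν E ε) :
    ∃ R : ℝ, ∃ᶠ N in atTop, ∃ μ : Measure H3, IsInvariantWitness f ν N R E ε μ := by
  obtain ⟨K, Ks, hKc, hloud, hshadow, hacc⟩ := h
  obtain ⟨R₀, hR₀⟩ := hKc.isBounded.subset_closedBall (0 : H3)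
  have hnear : ∀ᶠ N in atTop, ∀ a ∈ Ks N, ‖a‖ ≤ R₀ + 1 := by
    filter_upwards [hacc 1 one_pos] with N hN a ha
    obtain ⟨b, hb, hab⟩ := hN a ha
    have hb' : ‖b‖ ≤ R₀ := mem_closedBall_zero_iff.1 (hR₀ hb)
    have hsub : ‖a‖ - ‖b‖ ≤ ‖a - b‖ := norm_sub_norm_le a b
    linarith
  have hcar := hUSC ν f E ε K Ks hν hfs hKc hloud (hshadow.mono fun N hN => hN.2.2.1) hacc
  refine ⟨R₀ + 1, ((hshadow.and hcar).and hnear).frequently.mono ?_⟩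
  rintro N ⟨⟨⟨hne, hcl, hlev, hpath⟩, hcarN⟩, hnearN⟩
  obtain ⟨a, ha⟩ := hne
  obtain ⟨U, hUc, -, hUK, hU⟩ := hpath a ha
  have hlevU : ∀ t, 0 ≤ t → IsLevel N (U t) := fun t ht => hlev (U t) (hUK t ht)
  have hbound : ∀ t, 0 ≤ t → ‖U t‖ ≤ R₀ + 1 := fun t ht => hnearN (U t) (hUK t ht)
  have hΛ : Nonempty GeneralizedLimit := GeneralizedLimit.nonempty_holds
  obtain ⟨Λ⟩ := hΛ
  obtain ⟨μ, hμ, hinv⟩ := hKB ν f N (R₀ + 1) U hfs hUc hlevU hbound hU Λ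
  have hnull : μ (Ks N)ᶜ = 0 := hμ.measure_compl_eq_zero hcl le_rfl hUK
  have hae : ∀ᵐ u ∂μ, u ∈ Ks N := by
    rw [ae_iff]
    exact hnull
  obtain ⟨hE, hD⟩ := hcarN μ hμ.1 hnull hinv
  exact ⟨μ, hμ.1, hae.mono fun u hu => hlev u hu, hae.mono fun u hu => hnearN u hu, hinv, hE, hD⟩

/-- **Shadow data at every `j` ⇒ the Galerkin-invariant loud family** (body of `GalerkinInvariantLoud` at
`f`). [folklore] -/
theorem invariantFamily_of_shadowData (hKB : GalerkinKB) (hUSC : LoudCarrierUSC) {f : T3 → R3}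
    (hfs : Torus.IsSmooth f) {ν : ℕ → ℝ} (hν : ∀ j, 0 < ν j) {E ε : ℝ}
    (h : ∀ j : ℕ, ShadowData f (ν j) E ε) : InvariantFamily f ν E ε :=
  fun j => invariantWitnesses_of_shadowData hKB hUSC hfs (hν j) (h j)

/-- **The transferred line closes the crux**: KB → USC → GateShadows → `QuarticTightness` (through the landed
gate-relative anatomy S14). [folklore] -/
theorem quarticTightness_of_gateShadows (hKB : GalerkinKB) (hUSC : LoudCarrierUSC) (hS : GateShadows) :
    QuarticTightness := by
  rw [stub_quarticTightnessIffGateInvariantFamily]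
  intro f hfs hfd hfz ν E ε hν hν0 hε hG
  obtain ⟨E', ε', hε', hj⟩ := hS f hfs hfd hfz ν E ε hν hν0 hε hG
  exact ⟨E', ε', hε', invariantFamily_of_shadowData hKB hUSC hfs hν hj⟩

/-! ## Position: the transferred stub dominates the sibling's own XL stub -/

/-- **GateShadows ∧ QuarticGate ⇒ the sibling's `stub_indexedLoudShadows`** (verbatim conclusion): at the
gate's witness force the transferred stub delivers exactly the sibling's ∃-force shadow statement. So a lead
proving `GateShadows` proves the sibling's open XL stub on the way (given binder 1 of the route), never less.
[folklore] -/
theorem siblingStub_of_gateShadows (hS : GateShadows) (hG : QuarticGate) :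
    ∃ f : T3 → R3, Torus.IsSmooth f ∧ Torus.IsDivFree f ∧ Torus.HasZeroMean f ∧
      ∃ (ν : ℕ → ℝ) (E ε : ℝ), (∀ j, 0 < ν j) ∧ Tendsto ν atTop (𝓝 0) ∧ 0 < ε ∧
      ∀ j : ℕ, ∃ (K : Set H3) (Ks : ℕ → Set H3), IsCompact K ∧
        (∀ μ : Measure H3, IsProbabilityMeasure μ → μ Kᶜ = 0 →
          (∀ Φ : Torus.CylindricalTest (Fin 3),
            Integrable (fun u => Torus.nsGeneratorPairing (ν j) f u (Φ.grad u)) μ ∧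
              ∫ u, Torus.nsGeneratorPairing (ν j) f u (Φ.grad u) ∂μ = 0) →
          Torus.ensembleEnergy μ < E ∧ ε < Torus.ensembleDissipation (ν j) μ) ∧
        (∀ᶠ N in atTop, (Ks N).Nonempty ∧ IsClosed (Ks N) ∧ (∀ a ∈ Ks N, IsLevel N a) ∧
          ∀ a ∈ Ks N, ∃ U : ℝ → H3, ContinuousOn U (Ici 0) ∧ U 0 = a ∧ (∀ t, 0 ≤ t → U t ∈ Ks N) ∧
            ∀ b : T3 → R3, IsBandTest N b → ∀ s t : ℝ, 0 ≤ s → s ≤ t →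
              Torus.pairing (U t).1 b - Torus.pairing (U s).1 b =
                ∫ τ in s..t, Torus.nsGeneratorPairing (ν j) f (U τ) b) ∧
        (∀ η : ℝ, 0 < η → ∀ᶠ N in atTop, ∀ a ∈ Ks N, ∃ b ∈ K, ‖a - b‖ < η) := by
  obtain ⟨f, hfs, hfd, hfz, ν, E, ε, hν, hν0, hε, hj⟩ := hG
  obtain ⟨E', ε', hε', hS'⟩ := hS f hfs hfd hfz ν E ε hν hν0 hε hj
  exact ⟨f, hfs, hfd, hfz, ν, E', ε', hν, hν0, hε', fun j => hS' j⟩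

/-- **Conversely the crux does NOT obviously give GateShadows**: what the tree certifies is only
`QuarticTightness → (GateHyp ⇒ InvariantFamily)` (S14); an invariant loud Galerkin family carries no compact
NS-invariant loud carrier `K_j` (the Conley object is extra rigidity). Recorded as the one-way sandwich
`GateShadows ⇒ GateFloor-form of QT`; the missing converse is the census's "strictly stronger". [folklore] -/
theorem gateInvariantFamily_of_gateShadows (hKB : GalerkinKB) (hUSC : LoudCarrierUSC) (hS : GateShadows) :
    ∀ f : T3 → R3, Torus.IsSmooth f → Torus.IsDivFree f → Torus.HasZeroMean f →
      ∀ (ν : ℕ → ℝ) (E ε : ℝ), (∀ j, 0 < ν j) → Tendsto ν atTop (𝓝 0) → 0 < ε →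
      GateHyp f ν E ε → ∃ E' ε' : ℝ, 0 < ε' ∧ InvariantFamily f ν E' ε' :=
  stub_quarticTightnessIffGateInvariantFamily.1 (quarticTightness_of_gateShadows hKB hUSC hS)

/-! ## §S7 (census v3): sequence-free budgets are equivalent — the interesting direction, pure logic -/

/-- Budget monotonicity of invariant witnesses. -/
theorem invariantWitness_mono {f : T3 → R3} {ν : ℝ} {N : ℕ} {R E E' ε ε' : ℝ} {μ : Measure H3}
    (h : IsInvariantWitness f ν N R E ε μ) (hE : E ≤ E') (hε : ε' ≤ ε) :
    IsInvariantWitness f ν N R E' ε' μ :=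
  ⟨h.1, h.2.1, h.2.2.1, h.2.2.2.1, h.2.2.2.2.1.trans hE, hε.trans h.2.2.2.2.2⟩

/-- The SEQUENTIAL floor of a force (the UEF reading of the crux's conclusion, force by force). -/
def FloorSeq (f : T3 → R3) : Prop :=
  ∀ ν : ℕ → ℝ, (∀ j, 0 < ν j) → Tendsto ν atTop (𝓝 0) → ∃ E' ε' : ℝ, 0 < ε' ∧ InvariantFamily f ν E' ε'

/-- The INTERVAL floor of a force: one pair of budgets on a whole interval of viscosities `(0, ν₀]`. -/
def FloorInterval (f : T3 → R3) : Prop :=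
  ∃ E' ε' ν₀ : ℝ, 0 < ε' ∧ 0 < ν₀ ∧ ∀ ν : ℝ, 0 < ν → ν ≤ ν₀ →
    ∃ R : ℝ, ∃ᶠ N in atTop, ∃ μ : Measure H3, IsInvariantWitness f ν N R E' ε' μ

/-- **S7: the sequential floor already gives budgets uniform on an interval of viscosities** (diagonal
argument; no structure of NS is used beyond budget monotonicity). So "for all `ν ≤ ν₀`" is not a stronger
target than the crux's "along every null sequence" — and exposes no continuation parameter either. [folklore] -/
theorem floorInterval_of_floorSeq {f : T3 → R3} (h : FloorSeq f) : FloorInterval f := by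
  by_contra hcon
  have hfail : ∀ n : ℕ, ∃ ν : ℝ, 0 < ν ∧ ν ≤ 1 / ((n : ℝ) + 1) ∧
      ∀ R : ℝ, ¬ ∃ᶠ N in atTop, ∃ μ : Measure H3,
        IsInvariantWitness f ν N R ((n : ℝ) + 1) (1 / ((n : ℝ) + 1)) μ := by
    intro n
    by_contra hn
    push Not at hn
    exact hcon ⟨(n : ℝ) + 1, 1 / ((n : ℝ) + 1), 1 / ((n : ℝ) + 1), by positivity, by positivity,
      fun ν hν hνle => hn ν hν hνle⟩
  choose ν hν using hfail
  have hpos : ∀ j, 0 < ν j := fun j => (hν j).1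
  have hlim : Tendsto ν atTop (𝓝 0) := by
    refine squeeze_zero (fun j => (hpos j).le) (fun j => (hν j).2.1) ?_
    exact tendsto_one_div_add_atTop_nhds_zero_nat
  obtain ⟨E', ε', hε', hI⟩ := h ν hpos hlim
  -- an index whose diagonal budgets `(n+1, 1/(n+1))` are weaker than `(E', ε')`
  obtain ⟨n, hn⟩ := exists_nat_ge (max E' (1 / ε'))
  have hnE : E' ≤ (n : ℝ) + 1 := by
    have := (le_max_left E' (1 / ε')).trans hn
    linarith
  have hnε : 1 / ((n : ℝ) + 1) ≤ ε' := by
    have h1 : 1 / ε' ≤ (n : ℝ) + 1 := by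
      have := (le_max_right E' (1 / ε')).trans hn
      linarith
    rw [div_le_iff₀ (by positivity)]
    have h2 := (div_le_iff₀ hε').1 h1
    linarith
  obtain ⟨R, hR⟩ := hI n
  exact (hν n).2.2 R (hR.mono fun N ⟨μ, hμ⟩ => ⟨μ, invariantWitness_mono hμ hnE hnε⟩)

end Summit.AnomalousDissipation.AnomalousDissipation.Cruxes.QuarticTightness.StrategyCensusB1

end
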